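import Literature.AlgebraicGeometry.HodgeTheory.GeneralHodgePropertyCMType
import Literature.AlgebraicGeometry.HodgeTheory.SurjectivePullbackConiveauDescent
import HarnessLib

/-!
# Grothendieck's amended generalized Hodge conjecture descends along surjective morphisms:
# `GHC(X, i, r) ⟹ GHC(W, i, r)` for `g : X ↠ W`

Family `hodge`, layer `Literature/AlgebraicGeometry/HodgeTheory`; lane `lit-hodgefound` (Track 2 foundations,
Layer A1). THEOREMS ONLY (no definition, no named fact; D-0026).

`GHC(X, i, r)` is the tree's `GeneralHodgePropertyFor n X i r` (file `GeneralHodgePropertyCMType`;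
Grothendieck 1969 p. 300, Voisin I Conj. 11.37): every rationally spanned `W' ⊆ Hⁱ(X(ℂ); ℂ)` whose
pull-back to a Hodge model is a sub-Hodge structure and which lies in `Fʳ Hⁱ` is supported in codimension
`r`, `W' ≤ Nʳ Hⁱ(X(ℂ); ℂ) = supportedClasses X i r`. Arapura (2006), Lemma 4.2 with Cor. 1.2, prints the
inheritance of `GHC` by varieties dominated by (powers of) `X`, through André's motivated motives: «Assuming
`GHC(Xⁿ)`, the equality `Nᵖ H(Ξ) = 𝓛ᵖ H(Ξ)` forces a similar equality for `Y`». On the tree's carriers the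
case of a surjection `g : X ⟶ W` needs neither powers nor motives:

* §1 the three admissibility conditions are preserved by `g^*` for ANY morphism `g` («`φ^*` is a morphism
  of Hodge structures», Voisin I §7.3.2 p. 150): `IsRationallySpanned.map_complexBetti_map` (rational classes
  pull back to rational classes), `HodgeModel.IsSubHodge.map_of_hodgePQ` (the image of a sub-Hodge structure
  under a type-preserving map is a sub-Hodge structure; cf. the tree's `…map_range_of_hodgePQ` for the image
  of the whole cohomology), `HodgeModel.IsSubHodge.map_complexBetti_map`,
  `HodgeModel.map_hodgeFiltrationBetti_le` (`g^* Fʳ Hⁱ(W) ⊆ Fʳ Hⁱ(X)`), whence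
  **`HodgeModel.map_mem_ratSubHodgeInFilt`** (`g^*` of an admissible subspace is admissible);
* §2 **`generalHodgePropertyFor_of_surjective`** — for `g : X ⟶ W` SURJECTIVE, `GHC(X, i, r) ⟹ GHC(W, i, r)`:
  `GHC(X)` puts `g^* W'` in `Nʳ Hⁱ(X(ℂ); ℂ)`, and geometric coniveau descends along surjections of any
  relative dimension (`mem_supportedClasses_of_map_mem_of_surjective'`: `x = c⁻¹ g_*(ηʳ ∪ g^* x)`, Voisin I
  Lemma 7.28 with the wedge kept); `generalHodgePropertyFor_of_surjective_forall` (all `(i, r)` at once) and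
  `hodgeConjectureFor_of_generalHodgePropertyFor_of_surjective` (`GHC(X, 2p, p)` for all `p` ⟹ `HC(W)`,
  Grothendieck p. 301).

## References

* [Arapura2006] D. Arapura, Motivation for Hodge cycles, Adv. Math. 207 (2006), §1 Cor. 1.2, §4 Lemma 4.2.
* [GrothendieckTopology1969] A. Grothendieck, Hodge's general conjecture is false for trivial reasons,
  Topology 8 (1969), pp. 299–301.
* [VoisinHodgeI2002] [Voisin2002] C. Voisin, Hodge Theory and Complex Algebraic Geometry I, CUP 2002,
  §7.3.1, §7.3.2 (p. 150) with Lemma 7.28 and Remark 7.29, §11.3 Conj. 11.37.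
* [VoisinHodgeII2003] C. Voisin, Hodge Theory and Complex Algebraic Geometry II, CUP 2003, §9.2.4 Prop. 9.21 (ii).
-/

noncomputable section

open CategoryTheory AlgebraicGeometry
open Literature.AlgebraicTopology.SingularHomology
open Literature.AlgebraicGeometry.Motives (IsSmoothProjective ComplexPoints)

namespace Literature.AlgebraicGeometry.HodgeTheory

variable {n m : ℕ} {X W : Motives.SchemeOver ℂ}

/-! ### §1 `g^*` preserves the admissibility conditions (any morphism `g`) -/

/-- **Rationally spanned subspaces pull back to rationally spanned subspaces**: `g^*` of a rational class
is rational. [cite: VoisinHodgeI2002, §7.3.1 and §7.3.2 (p. 148)] -/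
theorem IsRationallySpanned.map_complexBetti_map (g : X ⟶ W) {i : ℕ} {W' : Submodule ℂ (complexBetti W i)}
    (hW' : IsRationallySpanned W') : IsRationallySpanned (W'.map (complexBetti.map g i).hom) := by
  refine (isRationallySpanned_iff_le _).2 ?_
  conv_lhs => rw [hW']
  rw [Submodule.map_span]
  refine Submodule.span_mono ?_
  rintro _ ⟨c, ⟨hc, hcQ⟩, rfl⟩
  refine ⟨Submodule.mem_map_of_mem hc, ?_⟩
  exact hcQ.pullback (Motives.AlgPoints.mapContinuous (L := ℂ) g)

/-- **The image of a sub-Hodge structure under a type-preserving map is a sub-Hodge structure** (Voisin I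
§7.3.1, on the tree's carriers): `B`, `A` Hodge models of `Y`, `X`; `G : Hᵃ(Y(ℂ); ℂ) → Hᵇ(X(ℂ); ℂ)` linear,
sending classes of type `(p, q)` (tested in `B`) to classes of some type `(p', q')` (tested in `A`); then for
every `W' ⊆ Hᵃ(Y(ℂ); ℂ)` whose pull-back to `B` is a sub-Hodge structure, the pull-back of `G(W')` to `A`
is a sub-Hodge structure (decompose `y ∈ W'` into its components `y_{p,q} ∈ W'`, of pure type; their images
are of pure type and lie in `G(W')`). The case `W' = ⊤` is the tree's `…map_range_of_hodgePQ`.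
[cite: VoisinHodgeI2002, §7.3.1 (7.5) and §7.3.2] [cite: GrothendieckTopology1969, p. 300] -/
theorem HodgeModel.IsSubHodge.map_of_hodgePQ {Y : Motives.SchemeOver ℂ} (B : HodgeModel m Y)
    (A : HodgeModel n X) {a b : ℕ} (G : complexBetti Y a →ₗ[ℂ] complexBetti X b)
    (hG : ∀ p q : ℕ, p + q = a → ∃ p' q' : ℕ, p' + q' = b ∧
      ∀ y : complexBetti Y a, B.pullback a y ∈ B.hodgePQ a p q → A.pullback b (G y) ∈ A.hodgePQ b p' q')
    {W' : Submodule ℂ (complexBetti Y a)} (hW' : B.IsSubHodge a (W'.map (B.pullback a).hom)) :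
    A.IsSubHodge b ((W'.map G).map (A.pullback b).hom) := by
  refine (A.isSubHodge_iff_le b _).2 ?_
  -- the target sum of pieces
  set T : Submodule ℂ (singularCohomology ℂ ℂ A.carrier b) :=
    ⨆ (p' : ℕ) (q' : ℕ) (_ : p' + q' = b), (W'.map G).map (A.pullback b).hom ⊓ A.hodgePQ b p' q' with hT
  -- the classes of `Hᵃ(Y^an; ℂ)` coming from a class of `W'` whose image lands in `T`
  let S : Submodule ℂ (singularCohomology ℂ ℂ B.carrier a) :=
    (W' ⊓ T.comap ((A.pullback b).hom ∘ₗ G)).map (B.pullback a).hom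
  -- each piece `B^* W' ∩ H^{p,q}` lies in `S`, by the type-shifting hypothesis
  have hS : ∀ p q : ℕ, p + q = a → W'.map (B.pullback a).hom ⊓ B.hodgePQ a p q ≤ S := by
    rintro p q hpq z ⟨⟨y, hy, rfl⟩, hz⟩
    obtain ⟨p', q', hpq', h⟩ := hG p q hpq
    refine ⟨y, ⟨hy, ?_⟩, rfl⟩
    change (A.pullback b).hom (G y) ∈ T
    exact Submodule.mem_iSup_of_mem p' (Submodule.mem_iSup_of_mem q' (Submodule.mem_iSup_of_mem hpq'
      ⟨⟨G y, Submodule.mem_map_of_mem hy, rfl⟩, h y hz⟩))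
  -- hence all of `B^* W'` does (it is a sub-Hodge structure)
  have hle : W'.map (B.pullback a).hom ≤ S :=
    hW'.le.trans (iSup_le fun p ↦ iSup_le fun q ↦ iSup_le fun hpq ↦ hS p q hpq)
  rintro _ ⟨_, ⟨y, hy, rfl⟩, rfl⟩
  obtain ⟨y', ⟨_, hy'⟩, hyy'⟩ := hle (Submodule.mem_map_of_mem hy)
  obtain rfl : y' = y := B.pullback_injective a hyy'
  exact hy'

/-- **`g^*` of a sub-Hodge structure is a sub-Hodge structure**: for a morphism `g : X ⟶ W` of smooth
projective complex varieties, Hodge models `A` of `W` and `B` of `X`, and `W' ⊆ Hⁱ(W(ℂ); ℂ)` with `A^* W'`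
a sub-Hodge structure, `B^*(g^* W')` is a sub-Hodge structure («`φ^*` is a morphism of Hodge structures»;
`IsOfHodgeType.map_of_isSmoothProjective`). [cite: VoisinHodgeI2002, §7.3.2 (p. 150) and §7.3.1] -/
theorem HodgeModel.IsSubHodge.map_complexBetti_map (A : HodgeModel m W) (B : HodgeModel n X)
    (hW : IsSmoothProjective m W) (hX : IsSmoothProjective n X) (g : X ⟶ W) {i : ℕ}
    {W' : Submodule ℂ (complexBetti W i)} (hW' : A.IsSubHodge i (W'.map (A.pullback i).hom)) :
    B.IsSubHodge i ((W'.map (complexBetti.map g i).hom).map (B.pullback i).hom) :=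
  hW'.map_of_hodgePQ A B (complexBetti.map g i).hom fun p q hpq ↦ ⟨p, q, hpq, fun y hy ↦
    (isOfHodgeType_iff_mem_hodgePQ hX B _).1
      (((isOfHodgeType_iff_mem_hodgePQ hW A y).2 hy).map_of_isSmoothProjective hX hW g)⟩

/-- **`g^* Fʳ Hⁱ(W) ⊆ Fʳ Hⁱ(X)`** for the Hodge filtrations read on `Hⁱ(−(ℂ); ℂ)` through Hodge models
`A` of `W`, `B` of `X` (`g^*` preserves the Hodge types, `Fʳ = ⊕_{p ≥ r} H^{p,q}`).
[cite: VoisinHodgeI2002, §7.3.2 (p. 150) and §7.1.1] -/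
theorem HodgeModel.map_hodgeFiltrationBetti_le (A : HodgeModel m W) (B : HodgeModel n X)
    (hW : IsSmoothProjective m W) (hX : IsSmoothProjective n X) (g : X ⟶ W) (i r : ℕ) :
    (A.hodgeFiltrationBetti i r).map (complexBetti.map g i).hom ≤ B.hodgeFiltrationBetti i r := by
  rintro _ ⟨c, hc, rfl⟩
  rw [SetLike.mem_coe, HodgeModel.mem_hodgeFiltrationBetti] at hc
  -- `Fʳ_A ⊆ A^*((g^*)⁻¹ Fʳ Hⁱ(X))`, piece by piece
  set S : Submodule ℂ (singularCohomology ℂ ℂ A.carrier i) :=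
    ((B.hodgeFiltrationBetti i r).comap (complexBetti.map g i).hom).map (A.pullback i).hom with hS
  have hle : A.hodgeFiltration i r ≤ S := by
    refine iSup_le fun p ↦ iSup_le fun q ↦ iSup_le fun hpq ↦ iSup_le fun hr ↦ fun z hz ↦ ?_
    obtain ⟨c₀, rfl⟩ := A.pullback_surjective i z
    refine ⟨c₀, ?_, rfl⟩
    change complexBetti.map g i c₀ ∈ B.hodgeFiltrationBetti i r
    rw [HodgeModel.mem_hodgeFiltrationBetti]
    exact B.hodgePQ_le_hodgeFiltration hpq hr ((isOfHodgeType_iff_mem_hodgePQ hX B _).1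
      (((isOfHodgeType_iff_mem_hodgePQ hW A c₀).2 hz).map_of_isSmoothProjective hX hW g))
  obtain ⟨c', hc', hcc'⟩ := hle hc
  obtain rfl : c' = c := A.pullback_injective i hcc'
  exact hc'

/-- **`g^*` of an admissible subspace is admissible**: if `W' ⊆ Hⁱ(W(ℂ); ℂ)` is rationally spanned, a
sub-Hodge structure after pull-back to the Hodge model `A` of `W`, and contained in `Fʳ`
(`W' ∈ A.ratSubHodgeInFilt i r`), then `g^* W' ∈ B.ratSubHodgeInFilt i r` for every Hodge model `B` of `X`
and every morphism `g : X ⟶ W`. [cite: VoisinHodgeI2002, §7.3.2 (p. 150) and §7.3.1]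
[cite: GrothendieckTopology1969, p. 300] -/
theorem HodgeModel.map_mem_ratSubHodgeInFilt (A : HodgeModel m W) (B : HodgeModel n X)
    (hW : IsSmoothProjective m W) (hX : IsSmoothProjective n X) (g : X ⟶ W) {i r : ℕ}
    {W' : Submodule ℂ (complexBetti W i)} (hW' : W' ∈ A.ratSubHodgeInFilt i r) :
    W'.map (complexBetti.map g i).hom ∈ B.ratSubHodgeInFilt i r :=
  ⟨hW'.1.map_complexBetti_map g, hW'.2.1.map_complexBetti_map A B hW hX g,
    (Submodule.map_mono hW'.2.2).trans (A.map_hodgeFiltrationBetti_le B hW hX g i r)⟩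

/-! ### §2 `GHC(X, i, r) ⟹ GHC(W, i, r)` along a surjection `X ↠ W` -/

/-- **GROTHENDIECK'S AMENDED GENERALIZED HODGE CONJECTURE DESCENDS ALONG SURJECTIVE MORPHISMS**: for a
surjective morphism `g : X ⟶ W` of smooth projective complex varieties (any relative dimension) and every
`(i, r)`, `GHC(X, i, r) ⟹ GHC(W, i, r)`. Given an admissible `W' ⊆ Hⁱ(W(ℂ); ℂ)`, `g^* W'` is admissible
(§1), so `GHC(X, i, r)` gives `g^* W' ⊆ Nʳ Hⁱ(X(ℂ); ℂ)`, and geometric coniveau descends along `g`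
(`mem_supportedClasses_of_map_mem_of_surjective'`: `x = c⁻¹ g_*(ηʳ ∪ g^* x)`). In print (through motivated
motives and for varieties dominated by powers): Arapura, Lemma 4.2 with Cor. 1.2.
[cite: Arapura2006, §4 Lemma 4.2 (clause GHC) and §1 Cor. 1.2] [cite: GrothendieckTopology1969, p. 300]
[cite: Voisin2002, §7.3.2 Lemma 7.28 and Remark 7.29] [cite: VoisinHodgeII2003, §9.2.4 Prop. 9.21 (ii)] -/
theorem generalHodgePropertyFor_of_surjective (hX : IsSmoothProjective n X) (hW : IsSmoothProjective m W)
    (g : X ⟶ W) [Surjective g.left] {i r : ℕ} (h : GeneralHodgePropertyFor n X i r) :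
    GeneralHodgePropertyFor m W i r := by
  refine ⟨nonempty_hodgeModel_holds hW, fun A W' hW' x hx ↦ ?_⟩
  obtain ⟨B⟩ := h.1
  exact mem_supportedClasses_of_map_mem_of_surjective' hX hW g
    (h.2 B _ (A.map_mem_ratSubHodgeInFilt B hW hX g hW') (Submodule.mem_map_of_mem hx))

/-- **`GHC(X) ⟹ GHC(W)` for all `(i, r)` at once** along a surjection `g : X ⟶ W`.
[cite: Arapura2006, §4 Lemma 4.2 (clause GHC) and §1 Cor. 1.2] -/
theorem generalHodgePropertyFor_of_surjective_forall (hX : IsSmoothProjective n X)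
    (hW : IsSmoothProjective m W) (g : X ⟶ W) [Surjective g.left]
    (h : ∀ i r : ℕ, GeneralHodgePropertyFor n X i r) (i r : ℕ) : GeneralHodgePropertyFor m W i r :=
  generalHodgePropertyFor_of_surjective hX hW g (h i r)

/-- **`GHC(X, 2p, p)` for all `p` ⟹ the Hodge conjecture for every `W` dominated by `X`** (Grothendieck
p. 301: in degree `2p` and coniveau `p` the amended conjecture is the usual Hodge conjecture;
`hodgeConjectureFor_of_generalHodgePropertyFor`). [cite: GrothendieckTopology1969, p. 301]
[cite: Arapura2006, §4 Lemma 4.2 and §1 Cor. 1.2] -/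
theorem hodgeConjectureFor_of_generalHodgePropertyFor_of_surjective (hX : IsSmoothProjective n X)
    (hW : IsSmoothProjective m W) (g : X ⟶ W) [Surjective g.left]
    (h : ∀ p : ℕ, GeneralHodgePropertyFor n X (2 * p) p) : HodgeConjectureFor m W :=
  hodgeConjectureFor_of_generalHodgePropertyFor fun p ↦ generalHodgePropertyFor_of_surjective hX hW g (h p)

end Literature.AlgebraicGeometry.HodgeTheory

end
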